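import Literature.NumberTheory.Sieve.BombieriFriedlanderIwaniecGrouping
import Literature.NumberTheory.Sieve.DivisorPowerSums
import HarnessLib

/-!
# Bombieri–Friedlander–Iwaniec 1986: fine boxes and multilinear expansion of the Heath-Brown pieces

Trunk `AntSieve`, companion to `Literature.NumberTheory.Sieve.BombieriFriedlanderIwaniecDecomposition`.
Everything here is PROVED; no number theory beyond bookkeeping.  BFI §15 (p. 245–246): "By an obvious
partition of the range of summation in (2.1) into `O((log x)^{14(A₁+1)})` intervals we reduce the
problem to estimating the sums `𝓔(M₁,…,M_j | N₁,…,N_j)` … where `𝓜_i, 𝓝_i` are intervals of the type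
`𝓜_i = [(1−Δ)M_i, M_i)`, … `Δ = ℒ^{−A₁}`."  We set up this partition for an arbitrary Dirichlet product
`∏_{i∈s} f_i` of arithmetic functions:

* Boxes (`BFI.boxLow/boxHigh/InBox/boxRestrict T Δ k`): the intervals `(T(1+Δ)^{−k−1}, T(1+Δ)^{−k}]`,
  `k = 0, 1, …`; every `1 ≤ n ≤ T` lies in exactly one box with `k < K` as soon as `(1+Δ)^K > T`
  (`sum_boxRestrict_apply`).
* Multilinear expansion (`prod_apply_eq_sum_prod_boxRestrict_apply`): for `n ≤ T`,
  `(∏_{i∈s} f_i)(n) = ∑_{κ : s → {0,…,K−1}} (∏_{i∈s} boxRestrict (κ i) f_i)(n)` (`Finset.prod_univ_sum`).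
* Dirichlet products: values on `[1, T]` depend only on the factors on `[1, T]`
  (`prod_apply_eq_of_eqOn`); supports multiply (`prod_apply_ne_zero_bounds`); products of
  `z`-rough-supported functions are `z`-rough-supported (`isRough_of_prod_apply_ne_zero`);
  `|∏ f_i| ≤ ∏ |f_i|` and monotonicity for nonnegative factors (`abs_prod_apply_le`,
  `prod_apply_le_prod_apply`), whence `∑_κ |∏_i g_{i,κ_i}| ≤ ∏_i ∑_k |g_{i,k}|` pointwise.
* The Heath-Brown piece as a product over `Fin (2j)` (`hbPiece_eq_prod_hbFactor`): `j` copies of the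
  truncated Möbius function, `j − 1` copies of `1`, one `log`.

## References

* E. Bombieri, J. B. Friedlander, H. Iwaniec, Acta Math. 156 (1986), §15 pp. 244–247.
  [BombieriFriedlanderIwaniecActa1986]
-/

open Finset Real
open scoped ArithmeticFunction.zeta ArithmeticFunction.sigma

namespace Literature.NumberTheory.Sieve

namespace BFI

/-! ### Values of Dirichlet products on an initial segment -/

/-- The values of `∏_{i∈s} f_i` on `[1, T]` depend only on the values of the factors on `[1, T]`.
[folklore] -/
theorem prod_apply_eq_of_eqOn {ι : Type*} [DecidableEq ι] (s : Finset ι)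
    {f g : ι → ArithmeticFunction ℝ} {T : ℕ} (h : ∀ i ∈ s, ∀ d : ℕ, d ≤ T → f i d = g i d) :
    ∀ n : ℕ, n ≤ T → (∏ i ∈ s, f i) n = (∏ i ∈ s, g i) n := by
  induction s using Finset.induction_on with
  | empty => intro n _; simp
  | @insert i s hi ih =>
      intro n hn
      rw [Finset.prod_insert hi, Finset.prod_insert hi, ArithmeticFunction.mul_apply,
        ArithmeticFunction.mul_apply]
      refine Finset.sum_congr rfl fun x hx => ?_
      obtain ⟨hxn, hn0⟩ := Nat.mem_divisorsAntidiagonal.1 hx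
      have h1 : x.1 ≤ T := (Nat.le_of_dvd (Nat.pos_of_ne_zero hn0) ⟨x.2, hxn.symm⟩).trans hn
      have h2 : x.2 ≤ T :=
        (Nat.le_of_dvd (Nat.pos_of_ne_zero hn0) ⟨x.1, by rw [mul_comm]; exact hxn.symm⟩).trans hn
      rw [h i (Finset.mem_insert_self i s) x.1 h1,
        ih (fun k hk d hd => h k (Finset.mem_insert_of_mem hk) d hd) x.2 h2]

/-! ### Supports multiply -/

/-- If every factor `f_i` (`i ∈ s`, `s` nonempty) is supported in `(a_i, b_i]` with `a_i ≥ 0`, then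
`∏_{i∈s} f_i` is supported in `(∏ a_i, ∏ b_i]`. [folklore] -/
theorem prod_apply_ne_zero_bounds {ι : Type*} [DecidableEq ι] {s : Finset ι} (hs : s.Nonempty)
    {f : ι → ArithmeticFunction ℝ} {a b : ι → ℝ} (ha : ∀ i ∈ s, 0 ≤ a i)
    (hf : ∀ i ∈ s, ∀ d : ℕ, f i d ≠ 0 → a i < d ∧ (d : ℝ) ≤ b i) {n : ℕ}
    (hn : (∏ i ∈ s, f i) n ≠ 0) : (∏ i ∈ s, a i) < n ∧ (n : ℝ) ≤ ∏ i ∈ s, b i := by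
  induction s using Finset.induction_on generalizing n with
  | empty => exact absurd rfl (Finset.nonempty_iff_ne_empty.1 hs)
  | @insert i s hi ih =>
      rw [Finset.prod_insert hi, ArithmeticFunction.mul_apply] at hn
      obtain ⟨x, hx, hx0⟩ := Finset.exists_ne_zero_of_sum_ne_zero hn
      have hf1 : f i x.1 ≠ 0 := left_ne_zero_of_mul hx0
      have hf2 : (∏ k ∈ s, f k) x.2 ≠ 0 := right_ne_zero_of_mul hx0
      obtain ⟨hxn, -⟩ := Nat.mem_divisorsAntidiagonal.1 hx
      obtain ⟨ha1, hb1⟩ := hf i (Finset.mem_insert_self i s) x.1 hf1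
      rw [Finset.prod_insert hi, Finset.prod_insert hi, ← hxn, Nat.cast_mul]
      rcases s.eq_empty_or_nonempty with hse | hsne
      · subst hse
        rw [Finset.prod_empty, ArithmeticFunction.one_apply] at hf2
        have hx2 : x.2 = 1 := by by_contra h; exact hf2 (if_neg h)
        rw [Finset.prod_empty, Finset.prod_empty, mul_one, mul_one, hx2, Nat.cast_one, mul_one]
        exact ⟨ha1, hb1⟩
      obtain ⟨ha2, hb2⟩ := ih hsne (fun k hk => ha k (Finset.mem_insert_of_mem hk))
        (fun k hk d hd => hf k (Finset.mem_insert_of_mem hk) d hd) hf2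
      have ha0 : 0 ≤ a i := ha i (Finset.mem_insert_self i s)
      have hpa0 : 0 ≤ ∏ k ∈ s, a k := Finset.prod_nonneg fun k hk => ha k (Finset.mem_insert_of_mem hk)
      have hx1 : (0 : ℝ) ≤ x.1 := Nat.cast_nonneg _
      constructor
      · calc a i * ∏ k ∈ s, a k ≤ (x.1 : ℝ) * ∏ k ∈ s, a k := mul_le_mul_of_nonneg_right ha1.le hpa0
          _ < (x.1 : ℝ) * x.2 := mul_lt_mul_of_pos_left ha2 (lt_of_le_of_lt ha0 ha1)
      · exact mul_le_mul hb1 hb2 (Nat.cast_nonneg _) (hx1.trans hb1)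

/-! ### Products of `z`-rough-supported functions -/

/-- A product of two `z`-rough numbers is `z`-rough. [folklore] -/
theorem IsRough.mul {z : ℝ} {m n : ℕ} (hm : IsRough z m) (hn : IsRough z n) : IsRough z (m * n) := by
  intro p hp
  rcases eq_or_ne m 0 with rfl | hm0
  · simp at hp
  rcases eq_or_ne n 0 with rfl | hn0
  · simp at hp
  rw [Nat.primeFactors_mul hm0 hn0, Finset.mem_union] at hp
  rcases hp with hp | hp
  · exact hm p hp
  · exact hn p hp

/-- If every factor is supported on `z`-rough integers, so is the Dirichlet product. [folklore] -/
theorem isRough_of_prod_apply_ne_zero {ι : Type*} [DecidableEq ι] (s : Finset ι)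
    {f : ι → ArithmeticFunction ℝ} {z : ℝ} (hf : ∀ i ∈ s, ∀ d : ℕ, f i d ≠ 0 → IsRough z d) {n : ℕ}
    (hn : (∏ i ∈ s, f i) n ≠ 0) : IsRough z n := by
  induction s using Finset.induction_on generalizing n with
  | empty =>
      simp only [Finset.prod_empty, ArithmeticFunction.one_apply, ne_eq, ite_eq_right_iff, one_ne_zero,
        imp_false, not_not] at hn
      subst hn
      intro p hp; simp at hp
  | @insert i s hi ih =>
      rw [Finset.prod_insert hi, ArithmeticFunction.mul_apply] at hn
      obtain ⟨x, hx, hx0⟩ := Finset.exists_ne_zero_of_sum_ne_zero hn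
      obtain ⟨hxn, -⟩ := Nat.mem_divisorsAntidiagonal.1 hx
      rw [← hxn]
      exact (hf i (Finset.mem_insert_self i s) x.1 (left_ne_zero_of_mul hx0)).mul
        (ih (fun k hk d hd => hf k (Finset.mem_insert_of_mem hk) d hd) (right_ne_zero_of_mul hx0))

/-- The values of `roughRestrict z F` are supported on `z`-rough integers. [folklore] -/
theorem isRough_of_roughRestrict_ne_zero {z : ℝ} {F : ArithmeticFunction ℝ} {d : ℕ}
    (h : roughRestrict z F d ≠ 0) : IsRough z d := by
  rw [roughRestrict_apply] at h
  by_contra hd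
  rw [if_neg hd] at h
  exact h rfl

/-- `roughRestrict` is idempotent. [folklore] -/
theorem roughRestrict_idem (z : ℝ) (F : ArithmeticFunction ℝ) :
    roughRestrict z (roughRestrict z F) = roughRestrict z F := by
  ext n
  simp only [roughRestrict_apply]
  split_ifs <;> rfl

/-- At a `z`-rough `n`, restricting every factor to `z`-rough integers changes nothing
(iterating `roughRestrict_mul_roughRestrict`; BFI's passage to the starred sums on p. 245).
[cite: BombieriFriedlanderIwaniecActa1986, §15 p. 245] -/
theorem roughRestrict_prod_roughRestrict {ι : Type*} [DecidableEq ι] (s : Finset ι) (z : ℝ)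
    (f : ι → ArithmeticFunction ℝ) :
    roughRestrict z (∏ i ∈ s, roughRestrict z (f i)) = roughRestrict z (∏ i ∈ s, f i) := by
  induction s using Finset.induction_on with
  | empty => simp
  | @insert i s hi ih =>
      rw [Finset.prod_insert hi, Finset.prod_insert hi]
      calc roughRestrict z (roughRestrict z (f i) * ∏ k ∈ s, roughRestrict z (f k))
          = roughRestrict z (roughRestrict z (roughRestrict z (f i)) *
              roughRestrict z (∏ k ∈ s, roughRestrict z (f k))) :=
            (roughRestrict_mul_roughRestrict z _ _).symm
        _ = roughRestrict z (roughRestrict z (f i) * roughRestrict z (∏ k ∈ s, f k)) := by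
            rw [roughRestrict_idem, ih]
        _ = roughRestrict z (f i * ∏ k ∈ s, f k) := roughRestrict_mul_roughRestrict z _ _

/-! ### Absolute values and monotonicity of Dirichlet products -/

/-- `|F|` as an arithmetic function. [folklore] -/
noncomputable def absAF (F : ArithmeticFunction ℝ) : ArithmeticFunction ℝ where
  toFun n := |F n|
  map_zero' := by simp

/-- Unfolding `absAF`. [folklore] -/
@[simp] theorem absAF_apply (F : ArithmeticFunction ℝ) (n : ℕ) : absAF F n = |F n| := rfl

/-- `|(∏ f_i)(n)| ≤ (∏ |f_i|)(n)`. [folklore] -/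
theorem abs_prod_apply_le {ι : Type*} [DecidableEq ι] (s : Finset ι) (f : ι → ArithmeticFunction ℝ)
    (n : ℕ) : |(∏ i ∈ s, f i) n| ≤ (∏ i ∈ s, absAF (f i)) n := by
  induction s using Finset.induction_on generalizing n with
  | empty => simp [ArithmeticFunction.one_apply]; split_ifs <;> simp
  | @insert i s hi ih =>
      rw [Finset.prod_insert hi, Finset.prod_insert hi, ArithmeticFunction.mul_apply,
        ArithmeticFunction.mul_apply]
      refine (Finset.abs_sum_le_sum_abs _ _).trans (Finset.sum_le_sum fun x _ => ?_)
      rw [abs_mul, absAF_apply]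
      exact mul_le_mul_of_nonneg_left (ih x.2) (abs_nonneg _)

/-- A Dirichlet product of pointwise nonnegative functions is pointwise nonnegative. [folklore] -/
theorem prod_apply_nonneg {ι : Type*} [DecidableEq ι] (s : Finset ι) {f : ι → ArithmeticFunction ℝ}
    (hf : ∀ i ∈ s, ∀ d, 0 ≤ f i d) (n : ℕ) : 0 ≤ (∏ i ∈ s, f i) n := by
  induction s using Finset.induction_on generalizing n with
  | empty => simp [ArithmeticFunction.one_apply]; split_ifs <;> simp
  | @insert i s hi ih =>
      rw [Finset.prod_insert hi, ArithmeticFunction.mul_apply]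
      exact Finset.sum_nonneg fun x _ => mul_nonneg (hf i (Finset.mem_insert_self i s) _)
        (ih (fun k hk d => hf k (Finset.mem_insert_of_mem hk) d) _)

/-- Monotonicity: `0 ≤ f_i ≤ g_i` pointwise implies `(∏ f_i)(n) ≤ (∏ g_i)(n)`. [folklore] -/
theorem prod_apply_le_prod_apply {ι : Type*} [DecidableEq ι] (s : Finset ι)
    {f g : ι → ArithmeticFunction ℝ} (hf : ∀ i ∈ s, ∀ d, 0 ≤ f i d) (hfg : ∀ i ∈ s, ∀ d, f i d ≤ g i d)
    (n : ℕ) : (∏ i ∈ s, f i) n ≤ (∏ i ∈ s, g i) n := by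
  induction s using Finset.induction_on generalizing n with
  | empty => exact le_rfl
  | @insert i s hi ih =>
      rw [Finset.prod_insert hi, Finset.prod_insert hi, ArithmeticFunction.mul_apply,
        ArithmeticFunction.mul_apply]
      refine Finset.sum_le_sum fun x _ => ?_
      have hg : ∀ k ∈ s, ∀ d, 0 ≤ g k d := fun k hk d => (hf k (Finset.mem_insert_of_mem hk) d).trans
        (hfg k (Finset.mem_insert_of_mem hk) d)
      exact mul_le_mul (hfg i (Finset.mem_insert_self i s) _)
        (ih (fun k hk d => hf k (Finset.mem_insert_of_mem hk) d)
          (fun k hk d => hfg k (Finset.mem_insert_of_mem hk) d) _)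
        (prod_apply_nonneg s (fun k hk d => hf k (Finset.mem_insert_of_mem hk) d) _)
        ((hf i (Finset.mem_insert_self i s) _).trans (hfg i (Finset.mem_insert_self i s) _))

/-- **Summing absolute values over a multilinear expansion**: for families `g i k` (`i ∈ s`, `k ∈ t`),
`∑_{κ ∈ s → t} |(∏_{i} g_{i,κ_i})(n)| ≤ (∏_{i} ∑_{k∈t} |g_{i,k}|)(n)` (`Finset.prod_univ_sum` applied to
the absolute values). [folklore] -/
theorem sum_abs_prod_apply_le {ι : Type*} [DecidableEq ι] [Fintype ι] (t : Finset ℕ)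
    (g : ι → ℕ → ArithmeticFunction ℝ) (n : ℕ) :
    ∑ κ ∈ Fintype.piFinset (fun _ : ι => t), |(∏ i, g i (κ i)) n| ≤
      (∏ i, ∑ k ∈ t, absAF (g i k)) n := by
  calc ∑ κ ∈ Fintype.piFinset (fun _ : ι => t), |(∏ i, g i (κ i)) n|
      ≤ ∑ κ ∈ Fintype.piFinset (fun _ : ι => t), (∏ i, absAF (g i (κ i))) n :=
        Finset.sum_le_sum fun κ _ => abs_prod_apply_le _ _ n
    _ = (∑ κ ∈ Fintype.piFinset (fun _ : ι => t), ∏ i, absAF (g i (κ i))) n :=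
        (HeathBrown.finset_sum_apply _ _ n).symm
    _ = (∏ i, ∑ k ∈ t, absAF (g i k)) n := by rw [Finset.prod_univ_sum]

/-! ### The fine boxes -/

section Boxes

variable (T Δ : ℝ)

/-- The lower end `T (1+Δ)^{−(k+1)}` of the `k`-th box below `T`. [cite: BombieriFriedlanderIwaniecActa1986, §15 p. 245] -/
noncomputable def boxLow (k : ℕ) : ℝ := T / (1 + Δ) ^ (k + 1)

/-- The upper end `T (1+Δ)^{−k}` of the `k`-th box. [cite: BombieriFriedlanderIwaniecActa1986, §15 p. 245] -/
noncomputable def boxHigh (k : ℕ) : ℝ := T / (1 + Δ) ^ k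

/-- `n` lies in the `k`-th box: `n ≥ 1` and `T(1+Δ)^{−k−1} < n ≤ T(1+Δ)^{−k}`. [cite: BombieriFriedlanderIwaniecActa1986, §15 p. 245] -/
def InBox (k n : ℕ) : Prop := 0 < n ∧ boxLow T Δ k < n ∧ (n : ℝ) ≤ boxHigh T Δ k

/-- `InBox` is decidable (classically). [folklore] -/
noncomputable instance instDecidableInBox (k n : ℕ) : Decidable (InBox T Δ k n) := by
  unfold InBox; infer_instance

/-- Restriction of an arithmetic function to the `k`-th box. [cite: BombieriFriedlanderIwaniecActa1986, §15 p. 245] -/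
noncomputable def boxRestrict (k : ℕ) (F : ArithmeticFunction ℝ) : ArithmeticFunction ℝ where
  toFun n := if InBox T Δ k n then F n else 0
  map_zero' := by simp [InBox]

/-- Unfolding `boxRestrict`. [folklore] -/
theorem boxRestrict_apply (k : ℕ) (F : ArithmeticFunction ℝ) (n : ℕ) :
    boxRestrict T Δ k F n = if InBox T Δ k n then F n else 0 := rfl

variable {T Δ}

/-- `boxHigh (k+1) = boxLow k`: consecutive boxes abut. [folklore] -/
theorem boxHigh_succ (k : ℕ) : boxHigh T Δ (k + 1) = boxLow T Δ k := rfl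

/-- `boxHigh k = (1+Δ) · boxLow k` (`Δ > −1`). [folklore] -/
theorem boxHigh_eq_mul_boxLow (hΔ : -1 < Δ) (k : ℕ) : boxHigh T Δ k = (1 + Δ) * boxLow T Δ k := by
  have h1 : (1 + Δ) ≠ 0 := by linarith
  unfold boxHigh boxLow
  rw [pow_succ]
  field_simp

/-- `0 < boxLow k` for `T > 0`, `Δ > −1`. [folklore] -/
theorem boxLow_pos (hT : 0 < T) (hΔ : -1 < Δ) (k : ℕ) : 0 < boxLow T Δ k := by
  unfold boxLow; have : 0 < 1 + Δ := by linarith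
  positivity

/-- The boxes decrease: `boxLow (k+1) ≤ boxLow k` for `Δ ≥ 0`. [folklore] -/
theorem boxLow_anti (hT : 0 < T) (hΔ : 0 ≤ Δ) {k l : ℕ} (hkl : k ≤ l) : boxLow T Δ l ≤ boxLow T Δ k := by
  unfold boxLow
  refine div_le_div_of_nonneg_left hT.le (by positivity) ?_
  exact pow_le_pow_right₀ (by linarith) (by omega)

/-- For `Δ > 0` and `T < (1+Δ)^K`: `boxHigh K' ≤ T/(1+Δ)^K < 1` for `K' ≥ K` (the boxes beyond `K`
contain no positive integer). [folklore] -/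
theorem boxHigh_lt_one (hΔ : 0 < Δ) {K : ℕ} (hK : T < (1 + Δ) ^ K) {k : ℕ} (hk : K ≤ k) :
    boxHigh T Δ k < 1 := by
  unfold boxHigh
  rw [div_lt_one (by positivity)]
  exact hK.trans_le (pow_le_pow_right₀ (by linarith) hk)

/-- Boxes with different indices are disjoint. [folklore] -/
theorem InBox.eq_of_inBox (hT : 0 < T) (hΔ : 0 ≤ Δ) {k l n : ℕ} (hk : InBox T Δ k n) (hl : InBox T Δ l n) :
    k = l := by
  by_contra hne
  wlog hkl : k < l generalizing k l
  · exact this hl hk (Ne.symm hne) (lt_of_le_of_ne (not_lt.1 hkl) (Ne.symm hne))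
  -- `n ≤ boxHigh l ≤ boxHigh (k+1) = boxLow k < n`
  have h1 : boxHigh T Δ l ≤ boxHigh T Δ (k + 1) := by
    unfold boxHigh
    refine div_le_div_of_nonneg_left hT.le (by positivity) ?_
    exact pow_le_pow_right₀ (by linarith) hkl
  rw [boxHigh_succ] at h1
  linarith [hk.2.1, hl.2.2]

/-- **The boxes partition `[1, T]`**: for `Δ > 0`, `0 < T < (1+Δ)^K` and `1 ≤ n ≤ T`,
`∑_{k<K} (boxRestrict k F)(n) = F(n)` (exactly one box contains `n`). [cite: BombieriFriedlanderIwaniecActa1986, §15 p. 245] -/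
theorem sum_boxRestrict_apply (hT : 0 < T) (hΔ : 0 < Δ) {K : ℕ} (hK : T < (1 + Δ) ^ K)
    (F : ArithmeticFunction ℝ) {n : ℕ} (hn1 : 1 ≤ n) (hnT : (n : ℝ) ≤ T) :
    ∑ k ∈ Finset.range K, boxRestrict T Δ k F n = F n := by
  -- the box containing `n`: the least `k` with `boxLow k < n`
  have hex : ∃ k, boxLow T Δ k < n := by
    refine ⟨K, ?_⟩
    calc boxLow T Δ K = boxHigh T Δ (K + 1) := (boxHigh_succ K).symm
      _ < 1 := boxHigh_lt_one hΔ hK (by omega)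
      _ ≤ n := by exact_mod_cast hn1
  classical
  set k₀ := Nat.find hex with hk₀
  have hk₀spec : boxLow T Δ k₀ < n := Nat.find_spec hex
  have hk₀min : ∀ k < k₀, ¬ boxLow T Δ k < n := fun k hk => Nat.find_min hex hk
  have hin : InBox T Δ k₀ n := by
    refine ⟨hn1, hk₀spec, ?_⟩
    rcases Nat.eq_zero_or_pos k₀ with h0 | hpos
    · rw [h0]; unfold boxHigh; simpa using hnT
    · have := hk₀min (k₀ - 1) (by omega)
      rw [not_lt] at this
      have heq : boxHigh T Δ k₀ = boxLow T Δ (k₀ - 1) := by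
        rw [← boxHigh_succ]; congr 1; omega
      rw [heq]; exact this
  have hk₀K : k₀ < K := by
    by_contra hge
    rw [not_lt] at hge
    have := boxHigh_lt_one hΔ hK hge
    have h1 : (1 : ℝ) ≤ n := by exact_mod_cast hn1
    linarith [hin.2.2]
  rw [Finset.sum_eq_single k₀]
  · rw [boxRestrict_apply, if_pos hin]
  · intro k _ hk
    rw [boxRestrict_apply, if_neg]
    intro hk'
    exact hk (hk'.eq_of_inBox hT hΔ.le hin)
  · intro h; exact absurd (Finset.mem_range.2 hk₀K) h

/-- On `[1, T]`, every factor equals the sum of its box restrictions; hence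
`(∏ f_i)(n) = (∏_i ∑_{k<K} boxRestrict k f_i)(n)` for `n ≤ T`. [folklore] -/
theorem prod_apply_eq_prod_sum_boxRestrict_apply {ι : Type*} [DecidableEq ι] (s : Finset ι)
    (hT : 0 < T) (hΔ : 0 < Δ) {K : ℕ} (hK : T < (1 + Δ) ^ K) (f : ι → ArithmeticFunction ℝ)
    {n : ℕ} (hnT : (n : ℝ) ≤ T) :
    (∏ i ∈ s, f i) n = (∏ i ∈ s, ∑ k ∈ Finset.range K, boxRestrict T Δ k (f i)) n := by
  refine prod_apply_eq_of_eqOn s (T := ⌊T⌋₊) (fun i _ d hd => ?_) n (Nat.le_floor hnT)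
  rcases Nat.eq_zero_or_pos d with rfl | hd1
  · simp
  · rw [HeathBrown.finset_sum_apply]
    exact (sum_boxRestrict_apply hT hΔ hK (f i) hd1 ((Nat.le_floor_iff hT.le).1 hd)).symm

/-- **Multilinear expansion into box-tuples**: for a finite index type `ι` and `n ≤ T`,
`(∏_i f_i)(n) = ∑_{κ : ι → {0,…,K−1}} (∏_i boxRestrict (κ i) f_i)(n)`.
[cite: BombieriFriedlanderIwaniecActa1986, §15 p. 245–246] -/
theorem prod_apply_eq_sum_prod_boxRestrict_apply {ι : Type*} [DecidableEq ι] [Fintype ι]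
    (hT : 0 < T) (hΔ : 0 < Δ) {K : ℕ} (hK : T < (1 + Δ) ^ K) (f : ι → ArithmeticFunction ℝ)
    {n : ℕ} (hnT : (n : ℝ) ≤ T) :
    (∏ i, f i) n = ∑ κ ∈ Fintype.piFinset (fun _ : ι => Finset.range K),
      (∏ i, boxRestrict T Δ (κ i) (f i)) n := by
  rw [prod_apply_eq_prod_sum_boxRestrict_apply Finset.univ hT hΔ hK f hnT, Finset.prod_univ_sum,
    HeathBrown.finset_sum_apply]

/-- The support of a box restriction. [folklore] -/
theorem boxRestrict_ne_zero {k : ℕ} {F : ArithmeticFunction ℝ} {n : ℕ} (h : boxRestrict T Δ k F n ≠ 0) :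
    InBox T Δ k n ∧ F n ≠ 0 := by
  rw [boxRestrict_apply] at h
  by_cases hin : InBox T Δ k n
  · exact ⟨hin, by rwa [if_pos hin] at h⟩
  · rw [if_neg hin] at h; exact absurd rfl h

/-- `|boxRestrict k F| ≤ |F|` pointwise. [folklore] -/
theorem abs_boxRestrict_le (k : ℕ) (F : ArithmeticFunction ℝ) (n : ℕ) : |boxRestrict T Δ k F n| ≤ |F n| := by
  rw [boxRestrict_apply]; split_ifs <;> simp

/-- `∑_{k<K} |boxRestrict k F|(n) ≤ |F(n)|` (at most one box contains `n`). [folklore] -/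
theorem sum_abs_boxRestrict_le (hT : 0 < T) (hΔ : 0 ≤ Δ) (K : ℕ) (F : ArithmeticFunction ℝ) (n : ℕ) :
    ∑ k ∈ Finset.range K, |boxRestrict T Δ k F n| ≤ |F n| := by
  by_cases h : ∃ k ∈ Finset.range K, InBox T Δ k n
  · obtain ⟨k₀, hk₀, hin⟩ := h
    rw [Finset.sum_eq_single k₀]
    · exact abs_boxRestrict_le k₀ F n
    · intro k _ hk
      rw [boxRestrict_apply, if_neg, abs_zero]
      exact fun hk' => hk (hk'.eq_of_inBox hT hΔ hin)
    · intro h'; exact absurd hk₀ h'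
  · push Not at h
    rw [Finset.sum_eq_zero fun k hk => by rw [boxRestrict_apply, if_neg (h k hk), abs_zero]]
    exact abs_nonneg _

/-- `boxRestrict` and `roughRestrict` commute. [folklore] -/
theorem roughRestrict_boxRestrict (z : ℝ) (k : ℕ) (F : ArithmeticFunction ℝ) :
    roughRestrict z (boxRestrict T Δ k F) = boxRestrict T Δ k (roughRestrict z F) := by
  ext n
  simp only [roughRestrict_apply, boxRestrict_apply]
  split_ifs <;> rfl

end Boxes

/-! ### The Heath-Brown piece as a product over `Fin (2j)` -/

/-- The `i`-th factor of the `j`-th Heath-Brown piece: the truncated Möbius function for `i < j`,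
the constant function `1` for `j ≤ i < 2j − 1`, and `log` for `i = 2j − 1`.
[cite: BombieriFriedlanderIwaniecActa1986, §2 Lemma 5 (2.1) p. 211] -/
noncomputable def hbFactor (U j : ℕ) (i : ℕ) : ArithmeticFunction ℝ :=
  if i < j then (moebiusTrunc U : ArithmeticFunction ℝ)
  else if i < 2 * j - 1 then (ζ : ArithmeticFunction ℝ) else ArithmeticFunction.log

/-- `hbPiece U j = ∏_{i < 2j} hbFactor U j i` for `j ≥ 1`. [cite: BombieriFriedlanderIwaniecActa1986, §2 (2.1) p. 211] -/
theorem hbPiece_eq_prod_hbFactor (U : ℕ) {j : ℕ} (hj : 1 ≤ j) :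
    hbPiece U j = ∏ i ∈ Finset.range (2 * j), hbFactor U j i := by
  -- split the range `[0, 2j)` as `[0, j) ∪ [j, 2j-1) ∪ {2j-1}`
  have h2j : 2 * j = (2 * j - 1) + 1 := by omega
  rw [h2j, Finset.prod_range_succ, ← Finset.prod_range_mul_prod_Ico _ (show j ≤ 2 * j - 1 by omega)]
  have h1 : ∏ i ∈ Finset.range j, hbFactor U j i = (moebiusTrunc U : ArithmeticFunction ℝ) ^ j := by
    rw [Finset.prod_congr rfl (fun i hi => by rw [hbFactor, if_pos (Finset.mem_range.1 hi)]),
      Finset.prod_const, Finset.card_range]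
  have h2 : ∏ i ∈ Finset.Ico j (2 * j - 1), hbFactor U j i = (ζ : ArithmeticFunction ℝ) ^ (j - 1) := by
    rw [Finset.prod_congr rfl (fun i hi => by
      obtain ⟨h1, h2⟩ := Finset.mem_Ico.1 hi
      rw [hbFactor, if_neg (not_lt.2 h1), if_pos h2]), Finset.prod_const, Nat.card_Ico]
    congr 1; omega
  have h3 : hbFactor U j (2 * j - 1) = ArithmeticFunction.log := by
    rw [hbFactor, if_neg (by omega), if_neg (lt_irrefl _)]
  rw [h1, h2, h3]
  rfl

end BFI

end Literature.NumberTheory.Sieve
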